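import Summits.QuantumAdvantage.AdviceFreeQNC0.RelativeHegedus
import Summits.QuantumAdvantage.AdviceFreeQNC0.ResidueAvoidanceLemmas
import Literature.Computability.MetaComplexity.HypercubeSchwartzZippel
import Summits.QuantumAdvantage.AdviceFreeQNC0.PLDAMSPrelims
import HarnessLib

/-!
# Cell qa-qnc0 (rung F-Q1, route RingFrame, crux α, line `product`): PLDAMS at every density

`pldams_allDensities`: there are `κ > 0`, `c > 0`, `n₀` with: for all `n ≥ n₀`, `r`, `d ≤ c·√n` and
`g ∈ lowDeg 𝔽₂ n d`, `κ·#{u : g u ≠ 0} ≤ #{u : g u ≠ 0, wt u ≡ r (mod 3)}` — the proportional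
low-degree avoidance principle PLDAMS of HOME/qa-qnc0-p1/TARGET.md §17.2/§18 (necessary special case
`Γ = (1+1_B)𝟙` of `LDMAPolylog`; rungs 1–3 of the ladder §18.2 were OPEN) for ALL densities.
PROOF (the cell's, qn-lit LIT-MEMO-11 §4).  `q = 2^j`, `75n < q² ≤ 1200n`; `N_m` = support points on
layer `m`.  (i) middle layers `n/4 − q ≤ m ≤ 3n/4 + q`, `m ≢ r`: the INNER partner `k ∈ {m ∓ q, m ∓ 2q}`,
`k ≡ r`, exists (`3 ∤ q`); `relativeHegedus` twice gives `ψ_m ≤ K_rel²ψ_k`, and `C(n,m) ≤ e^{32q²/n}C(n,k)`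
(`k` nearer the middle, or within `2q` of it); each `k` serves ≤ 4 layers.  (ii) outer layers
`|m − n/2| > n/4 + q` carry `≤ 2·4ⁿ/3^{⌈3n/4⌉} ≤ 2^{n−d}/4 ≤ #supp/4` points (`(3+1)ⁿ` and the
DeMillo–Lipton–Schwartz–Zippel bound).  So `(3/4)#supp ≤ (1 + 4K_rel²e^{32q²/n})·#class_r`.
[cite: Srinivasan2023, Lemma 3.1 (through `relativeHegedus`)]
WHAT THIS IS NOT: `κ ≈ e^{−10⁶}` (TARGET expects `e^{−Θ(c²)}`); PLDAMS is not `LDMAPolylog` (general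
`Γ`) nor α = `RingToElim`; no separation.  TARGET §17.3 Theorem U / §17.2 Cor.(b) become unconditional
once threaded by the planners (not done here).

## References

* S. Srinivasan, *A robust version of Hegedűs's lemma, with applications*, TheoretiCS 2 (2023)
  [Srinivasan2023].
-/

noncomputable section

namespace Summit.QuantumAdvantage.AdviceFreeQNC0

open Finset
open Literature.Computability.MetaComplexity Literature.Computability.MetaComplexity.Smolensky
open Literature.Computability.MetaComplexity.Hegedus

variable {n : ℕ}

/-! ### The theorem -/

/-- **PLDAMS at every density (`𝔽₂`, `d ≤ c√n`).** There are `κ > 0`, `c > 0`, `n₀` such that for all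
`n ≥ n₀`, `r`, `d ≤ c·√n` and every `g ∈ lowDeg 𝔽₂ n d`, at least a `κ`-fraction of the support of
`g` has Hamming weight `≡ r (mod 3)`.  The cell's (qa-qnc0; TARGET §17.2 PLDAMS / §18 rungs 1–3).
[cite: Srinivasan2023, Lemma 3.1 (through `relativeHegedus`)] -/
theorem pldams_allDensities :
    ∃ κ : ℝ, 0 < κ ∧ ∃ c : ℝ, 0 < c ∧ ∃ n₀ : ℕ, ∀ n : ℕ, n₀ ≤ n → ∀ r d : ℕ,
      (d : ℝ) ≤ c * Real.sqrt n → ∀ g : CubeFn (ZMod 2) n, g ∈ lowDeg (ZMod 2) n d →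
        κ * ((univ.filter fun u : Fin n → Bool => g u ≠ 0).card : ℝ) ≤
          ((univ.filter fun u : Fin n → Bool => g u ≠ 0 ∧ wt u % 3 = r % 3).card : ℝ) := by
  classical
  obtain ⟨cH, hcH, nH, hRel⟩ := relativeHegedus
  obtain ⟨Kc, hKc⟩ : ∃ Kc : ℝ,
      Kc = 4 * ((2000 * Real.exp (400 * 1200)) ^ 2 * Real.exp (8 * 4800)) := ⟨_, rfl⟩
  have hKcpos : 0 < Kc := by rw [hKc]; positivity
  refine ⟨3 / (4 * (1 + Kc)), by positivity, min (8 * cH) 8, lt_min (by positivity) (by norm_num),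
    max nH (2 ^ 18 * 1200), ?_⟩
  intro n hn r d hd g hg
  have hnH : nH ≤ n := le_trans (le_max_left _ _) hn
  have hnL : 2 ^ 18 * 1200 ≤ n := le_trans (le_max_right _ _) hn
  have hn0 : 0 < n := by omega
  have hnR : (0 : ℝ) < n := by exact_mod_cast hn0
  /- the trivial case `g = 0` -/
  by_cases hg0 : g = 0
  · subst hg0
    simp
  /- the scale `q`: a power of two with `75n < q² ≤ 1200n` -/
  obtain ⟨j, hmq, hq2m⟩ := exists_pow_two_btwn (Nat.sqrt (75 * n) + 1) (Nat.succ_pos _)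
  obtain ⟨q, hq⟩ : ∃ q : ℕ, q = 2 ^ j := ⟨_, rfl⟩
  rw [← hq] at hmq hq2m
  have hsq1 : 75 * n < (Nat.sqrt (75 * n) + 1) * (Nat.sqrt (75 * n) + 1) := Nat.lt_succ_sqrt _
  have hsq2 : Nat.sqrt (75 * n) * Nat.sqrt (75 * n) ≤ 75 * n := Nat.sqrt_le _
  have hsq3 : 0 < Nat.sqrt (75 * n) := Nat.sqrt_pos.2 (by omega)
  have hLn_lt : 75 * n < q * q := lt_of_lt_of_le hsq1 (Nat.mul_le_mul hmq.le hmq.le)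
  have hqq_le : q * q ≤ 1200 * n := by
    have h3 : q ≤ 4 * Nat.sqrt (75 * n) := by omega
    calc q * q ≤ (4 * Nat.sqrt (75 * n)) * (4 * Nat.sqrt (75 * n)) := Nat.mul_le_mul h3 h3
      _ = 16 * (Nat.sqrt (75 * n) * Nat.sqrt (75 * n)) := by ring
      _ ≤ 16 * (75 * n) := Nat.mul_le_mul_left _ hsq2
      _ = 1200 * n := by ring
  have h512 : 512 * q ≤ n := by
    have h : (512 * q) * (512 * q) ≤ n * n := by
      calc (512 * q) * (512 * q) = 262144 * (q * q) := by ring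
        _ ≤ 262144 * (1200 * n) := Nat.mul_le_mul_left _ hqq_le
        _ = (2 ^ 18 * 1200) * n := by ring
        _ ≤ n * n := Nat.mul_le_mul_right _ hnL
    exact Nat.mul_self_le_mul_self_iff.1 h
  have hq3 : q % 3 ≠ 0 := by rw [hq]; exact two_pow_mod_three_ne_zero j
  have hqpos : 0 < q := by rw [hq]; positivity
  have hqR : (0 : ℝ) < q := by exact_mod_cast hqpos
  have h75 : 75 * n ≤ q ^ 2 := by rw [sq]; exact hLn_lt.le
  have h64 : 64 * n < q * q := by omega
  have hqq_leR : (q : ℝ) ^ 2 ≤ 1200 * n := by rw [sq]; exact_mod_cast hqq_le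
  have hq2n : (q : ℝ) ^ 2 / n ≤ 1200 := by rw [div_le_iff₀ hnR]; exact hqq_leR
  /- degree: `d < c_H · q` and `d < q` -/
  have hsqrt : 8 * Real.sqrt n < q := by
    have h1 : (8 * Real.sqrt n) ^ 2 = 64 * n := by
      rw [mul_pow, Real.sq_sqrt hnR.le]; norm_num
    have h2 : (64 : ℝ) * n < (q : ℝ) ^ 2 := by
      rw [sq]; exact_mod_cast h64
    nlinarith [Real.sqrt_nonneg (n : ℝ), hqR]
  have hdq : (d : ℝ) < cH * q := by
    calc (d : ℝ) ≤ min (8 * cH) 8 * Real.sqrt n := hd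
      _ ≤ 8 * cH * Real.sqrt n := mul_le_mul_of_nonneg_right (min_le_left _ _) (Real.sqrt_nonneg _)
      _ = cH * (8 * Real.sqrt n) := by ring
      _ < cH * q := mul_lt_mul_of_pos_left hsqrt hcH
  have hdq' : d < q := by
    have : (d : ℝ) < q :=
      calc (d : ℝ) ≤ min (8 * cH) 8 * Real.sqrt n := hd
        _ ≤ 8 * Real.sqrt n := mul_le_mul_of_nonneg_right (min_le_right _ _) (Real.sqrt_nonneg _)
        _ < q := hsqrt
    exact_mod_cast this
  /- the two constants at this `q` -/
  obtain ⟨Kr, hKr⟩ : ∃ Kr : ℝ, Kr = 2000 * Real.exp (400 * (q : ℝ) ^ 2 / n) := ⟨_, rfl⟩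
  obtain ⟨ρ, hρ⟩ : ∃ ρ : ℝ, ρ = Real.exp (8 * ((2 * q : ℕ) : ℝ) ^ 2 / n) := ⟨_, rfl⟩
  have hKrpos : 0 < Kr := by rw [hKr]; positivity
  have hKr1 : 1 ≤ Kr := by
    rw [hKr]
    have : 1 ≤ Real.exp (400 * (q : ℝ) ^ 2 / n) := Real.one_le_exp (by positivity)
    linarith
  have hρpos : 0 < ρ := by rw [hρ]; positivity
  have hρ1 : 1 ≤ ρ := by rw [hρ]; exact Real.one_le_exp (by positivity)
  have hKrle : Kr ≤ 2000 * Real.exp (400 * 1200) := by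
    rw [hKr]
    refine mul_le_mul_of_nonneg_left (Real.exp_le_exp.2 ?_) (by norm_num)
    rw [mul_div_assoc]
    linarith
  have hρle : ρ ≤ Real.exp (8 * 4800) := by
    rw [hρ]
    refine Real.exp_le_exp.2 ?_
    push_cast
    rw [mul_div_assoc, show (2 * (q : ℝ)) ^ 2 / n = 4 * ((q : ℝ) ^ 2 / n) by ring]
    linarith
  have hKrρ : 4 * (Kr ^ 2 * ρ) ≤ Kc := by
    rw [hKc]
    refine mul_le_mul_of_nonneg_left (mul_le_mul ?_ hρle hρpos.le (by positivity)) (by norm_num)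
    exact pow_le_pow_left₀ hKrpos.le hKrle 2
  /- layer sums -/
  obtain ⟨N, hN⟩ : ∃ N : ℕ → ℕ, N = fun m => ((layer n m).filter fun u => g u ≠ 0).card := ⟨_, rfl⟩
  have hNm : ∀ m, ((layer n m).filter fun u => g u ≠ 0).card = N m := fun m => by rw [hN]
  have hBge : (2 : ℝ) ^ (n - d) ≤ ((univ.filter fun u : Fin n → Bool => g u ≠ 0).card : ℝ) := by
    exact_mod_cast two_pow_le_card_support hg hg0
  rw [card_filter_ne_zero_eq_sum] at hBge ⊢
  rw [card_filter_ne_zero_mod_eq_sum]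
  simp only [hNm] at hBge ⊢
  push_cast at hBge ⊢
  have hN_le_C : ∀ m, (N m : ℝ) ≤ n.choose m := fun m => by
    rw [← hNm]; exact_mod_cast card_filter_layer_le_choose g m
  have hN_eq : ∀ {m}, m ≤ n → (N m : ℝ) = nzFrac g m * n.choose m := fun hm => by
    rw [← hNm]; exact card_filter_layer_eq_nzFrac_mul g hm
  have hN_nonneg : ∀ m, (0 : ℝ) ≤ N m := fun m => Nat.cast_nonneg _
  obtain ⟨T, hT⟩ : ∃ T : ℝ, T = ∑ m ∈ range (n + 1), (N m : ℝ) := ⟨_, rfl⟩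
  obtain ⟨Cr, hCr⟩ : ∃ Cr : ℝ, Cr = ∑ m ∈ (range (n + 1)).filter (fun m => m % 3 = r % 3),
      (N m : ℝ) := ⟨_, rfl⟩
  rw [← hT] at hBge ⊢
  rw [← hCr]
  have hCr_nonneg : 0 ≤ Cr := by rw [hCr]; exact sum_nonneg fun m _ => hN_nonneg m
  /- (ii) the outer layers: at most `T/4` points -/
  obtain ⟨s, hs⟩ : ∃ s : ℕ, s = n - n / 4 := ⟨_, rfl⟩
  have hs2 : n + d + 3 ≤ 3 * (s / 2) := by omega
  have htail : ∑ m ∈ (range (n + 1)).filter (fun m => s ≤ m), (n.choose m : ℝ) ≤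
      (2 : ℝ) ^ (n - d - 3) := by
    have h1 : (3 : ℝ) ^ s * ∑ m ∈ (range (n + 1)).filter (fun m => s ≤ m), (n.choose m : ℝ) ≤
        (4 : ℝ) ^ n := by exact_mod_cast three_pow_mul_tail_le n s
    have h2 : (2 : ℝ) ^ (n + d + 3) ≤ (3 : ℝ) ^ s := by
      have : (2 : ℝ) ^ (n + d + 3) ≤ (2 : ℝ) ^ (3 * (s / 2)) := pow_le_pow_right₀ (by norm_num) hs2
      exact this.trans (by exact_mod_cast two_pow_le_three_pow s)
    have h3 : (4 : ℝ) ^ n = (2 : ℝ) ^ (n + d + 3) * (2 : ℝ) ^ (n - d - 3) := by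
      rw [← pow_add, show n + d + 3 + (n - d - 3) = 2 * n by omega, pow_mul]; norm_num
    have hS : 0 ≤ ∑ m ∈ (range (n + 1)).filter (fun m => s ≤ m), (n.choose m : ℝ) :=
      sum_nonneg fun m _ => Nat.cast_nonneg _
    by_contra hlt
    rw [not_le] at hlt
    have : (4 : ℝ) ^ n < (3 : ℝ) ^ s * ∑ m ∈ (range (n + 1)).filter (fun m => s ≤ m),
        (n.choose m : ℝ) := by
      rw [h3]
      calc (2 : ℝ) ^ (n + d + 3) * (2 : ℝ) ^ (n - d - 3)
          < (2 : ℝ) ^ (n + d + 3) * ∑ m ∈ (range (n + 1)).filter (fun m => s ≤ m),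
              (n.choose m : ℝ) := mul_lt_mul_of_pos_left hlt (by positivity)
        _ ≤ _ := mul_le_mul_of_nonneg_right h2 hS
    linarith
  obtain ⟨mid, hmid⟩ : ∃ mid : ℕ → Prop, mid = fun m => n ≤ 4 * m + 4 * q ∧ 4 * m ≤ 3 * n + 4 * q := ⟨_, rfl⟩
  have hjunk : ∑ m ∈ (range (n + 1)).filter (fun m => ¬ mid m), (N m : ℝ) ≤ T / 4 := by
    have hpt : ∀ m ∈ (range (n + 1)).filter (fun m => ¬ mid m), (N m : ℝ) ≤
        (if s ≤ m then (n.choose m : ℝ) else 0) + (if s ≤ n - m then (n.choose m : ℝ) else 0) := by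
      intro m hm
      rw [mem_filter, mem_range, hmid] at hm
      have hC : (0 : ℝ) ≤ n.choose m := Nat.cast_nonneg _
      rcases not_and_or.1 hm.2 with h | h
      · have : s ≤ n - m := by omega
        rw [if_pos this]
        have := hN_le_C m
        split_ifs <;> linarith
      · have : s ≤ m := by omega
        rw [if_pos this]
        have := hN_le_C m
        split_ifs <;> linarith
    have hrefl : ∑ m ∈ range (n + 1), (if s ≤ n - m then (n.choose m : ℝ) else 0) =
        ∑ m ∈ range (n + 1), (if s ≤ m then (n.choose m : ℝ) else 0) := by
      have := Finset.sum_range_reflect (fun m => if s ≤ m then (n.choose m : ℝ) else 0) (n + 1)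
      rw [← this]
      refine sum_congr rfl fun m hm => ?_
      have hmn : m ≤ n := Nat.lt_succ_iff.1 (mem_range.1 hm)
      simp only [Nat.add_sub_cancel]
      rw [Nat.choose_symm hmn]
    have hif : ∑ m ∈ range (n + 1), (if s ≤ m then (n.choose m : ℝ) else 0) =
        ∑ m ∈ (range (n + 1)).filter (fun m => s ≤ m), (n.choose m : ℝ) := by
      rw [sum_filter]
    have h2T : (2 : ℝ) ^ (n - d - 3) ≤ T / 8 := by
      rw [le_div_iff₀ (by norm_num : (0 : ℝ) < 8)]
      have : (2 : ℝ) ^ (n - d - 3) * 8 = (2 : ℝ) ^ (n - d) := by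
        rw [show (8 : ℝ) = 2 ^ 3 by norm_num, ← pow_add]
        congr 1; omega
      rw [this]; exact hBge
    calc ∑ m ∈ (range (n + 1)).filter (fun m => ¬ mid m), (N m : ℝ)
        ≤ ∑ m ∈ (range (n + 1)).filter (fun m => ¬ mid m),
            ((if s ≤ m then (n.choose m : ℝ) else 0) + (if s ≤ n - m then (n.choose m : ℝ) else 0)) :=
          sum_le_sum hpt
      _ ≤ ∑ m ∈ range (n + 1),
            ((if s ≤ m then (n.choose m : ℝ) else 0) + (if s ≤ n - m then (n.choose m : ℝ) else 0)) :=
          sum_le_sum_of_subset_of_nonneg (filter_subset _ _) fun m _ _ => by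
            apply add_nonneg <;> split_ifs <;> first | exact Nat.cast_nonneg _ | exact le_rfl
      _ = 2 * ∑ m ∈ (range (n + 1)).filter (fun m => s ≤ m), (n.choose m : ℝ) := by
          rw [sum_add_distrib, hrefl, hif]; ring
      _ ≤ 2 * (2 : ℝ) ^ (n - d - 3) := by linarith [htail]
      _ ≤ T / 4 := by linarith [h2T]
  /- (i) the middle layers `m ≢ r`: the inner partner -/
  obtain ⟨kf, hkf⟩ : ∃ kf : ℕ → ℕ, kf = fun m =>
      if n ≤ 2 * m then (if (m - q) % 3 = r % 3 then m - q else m - 2 * q)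
      else (if (m + q) % 3 = r % 3 then m + q else m + 2 * q) := ⟨_, rfl⟩
  obtain ⟨A, hA⟩ : ∃ A : Finset ℕ,
      A = ((range (n + 1)).filter (fun m => mid m)).filter (fun m => ¬(m % 3 = r % 3)) := ⟨_, rfl⟩
  have hAmem : ∀ m ∈ A, m ≤ n ∧ (n ≤ 4 * m + 4 * q ∧ 4 * m ≤ 3 * n + 4 * q) ∧ m % 3 ≠ r % 3 := by
    intro m hm
    simp only [hA, hmid, mem_filter, mem_range] at hm
    exact ⟨by omega, hm.1.2, hm.2⟩
  -- residues: `m, m ∓ q, m ∓ 2q` are pairwise distinct mod 3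
  have hres3 : ∀ m, m % 3 ≠ r % 3 → 2 * q ≤ m → (m - q) % 3 ≠ r % 3 → (m - 2 * q) % 3 = r % 3 :=
    fun m h1 h2 h3 => mod3_partner_down hq3 h2 h1 h3
  have hres3' : ∀ m, m % 3 ≠ r % 3 → (m + q) % 3 ≠ r % 3 → (m + 2 * q) % 3 = r % 3 :=
    fun m h1 h3 => mod3_partner_up hq3 h1 h3
  have hkfacts : ∀ m ∈ A, kf m % 3 = r % 3 ∧ kf m ≤ n ∧
      nzFrac g m ≤ Kr ^ 2 * nzFrac g (kf m) ∧ (n.choose m : ℝ) ≤ ρ * n.choose (kf m) ∧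
      (m = kf m + q ∨ m = kf m + 2 * q ∨ m + q = kf m ∨ m + 2 * q = kf m) := by
    intro m hm
    obtain ⟨hmn, ⟨hlo, hhi⟩, hne⟩ := hAmem m hm
    have h16 : 8 * (2 * q) ≤ n := by omega
    -- relative Hegedűs at a middle layer `k`
    have hRk : ∀ k, 100 * q < k → k + 100 * q < n → n ≤ 4 * k → 4 * k ≤ 3 * n →
        nzFrac g (k + q) ≤ Kr * nzFrac g k ∧ nzFrac g (k - q) ≤ Kr * nzFrac g k := by
      intro k h1 h2 h3 h4
      have := hRel n hnH k q d ⟨j, hq⟩ h1 h2 h3 h4 h75 hdq g hg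
      rw [← hKr] at this
      exact this
    have hψnn : ∀ k, 0 ≤ nzFrac g k := fun k => nzFrac_nonneg g k
    by_cases hup : n ≤ 2 * m
    · -- upper half: partners `m - q`, `m - 2q`
      have hkf1 : kf m = if (m - q) % 3 = r % 3 then m - q else m - 2 * q := by
        simp only [hkf, if_pos hup]
      have h2q : 2 * q ≤ m := by omega
      obtain ⟨ha1, ha2⟩ := hRk (m - q) (by omega) (by omega) (by omega) (by omega)
      obtain ⟨hb1, hb2⟩ := hRk (m - 2 * q) (by omega) (by omega) (by omega) (by omega)
      have e1 : m - q + q = m := by omega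
      have e2 : m - 2 * q + q = m - q := by omega
      rw [e1] at ha1
      rw [e2] at hb1
      -- `ψ_m ≤ Kr ψ_{m-q} ≤ Kr² ψ_{m-2q}` and `ψ_m ≤ Kr² ψ_{m-q}`
      have hm1 : nzFrac g m ≤ Kr ^ 2 * nzFrac g (m - q) := by
        calc nzFrac g m ≤ Kr * nzFrac g (m - q) := ha1
          _ ≤ Kr ^ 2 * nzFrac g (m - q) := by
              rw [sq, mul_assoc]
              exact le_mul_of_one_le_left (mul_nonneg hKrpos.le (hψnn _)) hKr1
      have hm2 : nzFrac g m ≤ Kr ^ 2 * nzFrac g (m - 2 * q) := by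
        calc nzFrac g m ≤ Kr * nzFrac g (m - q) := ha1
          _ ≤ Kr * (Kr * nzFrac g (m - 2 * q)) := mul_le_mul_of_nonneg_left hb1 hKrpos.le
          _ = Kr ^ 2 * nzFrac g (m - 2 * q) := by ring
      -- binomial comparison with an inner layer `k ≤ m`, `k ≥ m - 2q`
      have hbin : ∀ k, k ≤ m → m ≤ k + 2 * q → (n.choose m : ℝ) ≤ ρ * n.choose k := by
        intro k hk1 hk2
        by_cases hk : n ≤ 2 * k
        · calc (n.choose m : ℝ) ≤ n.choose k := by
                exact_mod_cast choose_le_choose_of_half_le hk hk1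
            _ ≤ ρ * n.choose k := le_mul_of_one_le_left (Nat.cast_nonneg _) hρ1
        · have := choose_le_exp_mul_choose h16 (by omega : n / 2 ≤ k + 2 * q) (by omega) m
          rw [← hρ] at this
          exact this
      split_ifs at hkf1 with hc
      · rw [hkf1]
        exact ⟨hc, by omega, hm1, hbin (m - q) (by omega) (by omega), Or.inl (by omega)⟩
      · rw [hkf1]
        exact ⟨hres3 m hne h2q hc, by omega, hm2, hbin (m - 2 * q) (by omega) (by omega),
          Or.inr (Or.inl (by omega))⟩
    · -- lower half: partners `m + q`, `m + 2q`
      rw [not_le] at hup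
      have hkf1 : kf m = if (m + q) % 3 = r % 3 then m + q else m + 2 * q := by
        simp only [hkf, if_neg (not_le.2 hup)]
      obtain ⟨ha1, ha2⟩ := hRk (m + q) (by omega) (by omega) (by omega) (by omega)
      obtain ⟨hb1, hb2⟩ := hRk (m + 2 * q) (by omega) (by omega) (by omega) (by omega)
      have e1 : m + q - q = m := by omega
      have e2 : m + 2 * q - q = m + q := by omega
      rw [e1] at ha2
      rw [e2] at hb2
      have hm1 : nzFrac g m ≤ Kr ^ 2 * nzFrac g (m + q) := by
        calc nzFrac g m ≤ Kr * nzFrac g (m + q) := ha2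
          _ ≤ Kr ^ 2 * nzFrac g (m + q) := by
              rw [sq, mul_assoc]
              exact le_mul_of_one_le_left (mul_nonneg hKrpos.le (hψnn _)) hKr1
      have hm2 : nzFrac g m ≤ Kr ^ 2 * nzFrac g (m + 2 * q) := by
        calc nzFrac g m ≤ Kr * nzFrac g (m + q) := ha2
          _ ≤ Kr * (Kr * nzFrac g (m + 2 * q)) := mul_le_mul_of_nonneg_left hb2 hKrpos.le
          _ = Kr ^ 2 * nzFrac g (m + 2 * q) := by ring
      have hbin : ∀ k, m ≤ k → k ≤ m + 2 * q → (n.choose m : ℝ) ≤ ρ * n.choose k := by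
        intro k hk1 hk2
        by_cases hk : k ≤ n / 2
        · calc (n.choose m : ℝ) ≤ n.choose k := by
                exact_mod_cast Literature.Barriers.ValiantsHypothesis.choose_le_choose_of_le_half hk1 hk
            _ ≤ ρ * n.choose k := le_mul_of_one_le_left (Nat.cast_nonneg _) hρ1
        · have := choose_le_exp_mul_choose h16 (by omega : n / 2 ≤ k + 2 * q) (by omega) m
          rw [← hρ] at this
          exact this
      split_ifs at hkf1 with hc
      · rw [hkf1]
        exact ⟨hc, by omega, hm1, hbin (m + q) (by omega) (by omega),
          Or.inr (Or.inr (Or.inl rfl))⟩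
      · rw [hkf1]
        exact ⟨hres3' m hne hc, by omega, hm2, hbin (m + 2 * q) (by omega) (by omega),
          Or.inr (Or.inr (Or.inr rfl))⟩
  /- domination `N m ≤ Kr²ρ · N (kf m)` on `A` -/
  have hdom : ∀ m ∈ A, (N m : ℝ) ≤ Kr ^ 2 * ρ * N (kf m) := by
    intro m hm
    obtain ⟨hmn, -, -⟩ := hAmem m hm
    obtain ⟨-, hkn, hψ, hC, -⟩ := hkfacts m hm
    rw [hN_eq hmn, hN_eq hkn]
    calc nzFrac g m * (n.choose m : ℝ)
        ≤ (Kr ^ 2 * nzFrac g (kf m)) * (ρ * n.choose (kf m)) :=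
          mul_le_mul hψ hC (Nat.cast_nonneg _) (mul_nonneg (pow_nonneg hKrpos.le 2) (nzFrac_nonneg g _))
      _ = Kr ^ 2 * ρ * (nzFrac g (kf m) * n.choose (kf m)) := by ring
  /- each class-`r` layer is the partner of at most four middle layers -/
  have hsum_kf : ∑ m ∈ A, (N (kf m) : ℝ) ≤ 4 * Cr := by
    have hmaps : ∀ m ∈ A, kf m ∈ (range (n + 1)).filter (fun k => k % 3 = r % 3) := by
      intro m hm
      obtain ⟨h3, hkn, -, -, -⟩ := hkfacts m hm
      exact mem_filter.2 ⟨mem_range.2 (by omega), h3⟩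
    rw [← sum_fiberwise_of_maps_to hmaps, hCr, mul_sum]
    refine sum_le_sum fun k hk => ?_
    have hfib : ∀ m ∈ A.filter (fun m => kf m = k), (N (kf m) : ℝ) = N k := by
      intro m hm; rw [(mem_filter.1 hm).2]
    rw [sum_congr rfl hfib, sum_const, nsmul_eq_mul]
    refine mul_le_mul_of_nonneg_right ?_ (hN_nonneg k)
    have hsub : A.filter (fun m => kf m = k) ⊆ ({k + q, k + 2 * q, k - q, k - 2 * q} : Finset ℕ) := by
      intro m hm
      rw [mem_filter] at hm
      obtain ⟨-, -, -, -, hcases⟩ := hkfacts m hm.1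
      rw [hm.2] at hcases
      simp only [mem_insert, mem_singleton]
      omega
    exact_mod_cast (card_le_card hsub).trans (card_quad_le _ _ _ _)
  /- assembly -/
  have hsplit1 : ∑ m ∈ (range (n + 1)).filter (fun m => m % 3 = r % 3), (N m : ℝ) +
      ∑ m ∈ (range (n + 1)).filter (fun m => ¬(m % 3 = r % 3)), (N m : ℝ) = T := by
    rw [hT]; exact sum_filter_add_sum_filter_not _ _ _
  have hsplit2 : ∑ m ∈ ((range (n + 1)).filter (fun m => ¬(m % 3 = r % 3))).filter (fun m => mid m),
        (N m : ℝ) +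
      ∑ m ∈ ((range (n + 1)).filter (fun m => ¬(m % 3 = r % 3))).filter (fun m => ¬ mid m),
        (N m : ℝ) =
      ∑ m ∈ (range (n + 1)).filter (fun m => ¬(m % 3 = r % 3)), (N m : ℝ) :=
    sum_filter_add_sum_filter_not _ _ _
  have hA_eq : ((range (n + 1)).filter (fun m => ¬(m % 3 = r % 3))).filter (fun m => mid m) = A := by
    rw [hA, filter_filter, filter_filter]
    exact filter_congr fun m _ => and_comm
  have hmidsum : ∑ m ∈ A, (N m : ℝ) ≤ Kc * Cr := by
    calc ∑ m ∈ A, (N m : ℝ) ≤ ∑ m ∈ A, Kr ^ 2 * ρ * (N (kf m) : ℝ) := sum_le_sum hdom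
      _ = Kr ^ 2 * ρ * ∑ m ∈ A, (N (kf m) : ℝ) := by rw [mul_sum]
      _ ≤ Kr ^ 2 * ρ * (4 * Cr) := mul_le_mul_of_nonneg_left hsum_kf (by positivity)
      _ = 4 * (Kr ^ 2 * ρ) * Cr := by ring
      _ ≤ Kc * Cr := mul_le_mul_of_nonneg_right hKrρ hCr_nonneg
  have hjunk' : ∑ m ∈ ((range (n + 1)).filter (fun m => ¬(m % 3 = r % 3))).filter
      (fun m => ¬ mid m), (N m : ℝ) ≤ T / 4 := by
    refine le_trans (sum_le_sum_of_subset_of_nonneg ?_ fun m _ _ => hN_nonneg m) hjunk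
    intro m hm
    simp only [mem_filter] at hm ⊢
    exact ⟨hm.1.1, hm.2⟩
  rw [hA_eq] at hsplit2
  rw [← hCr] at hsplit1
  have hTle : T ≤ Cr + Kc * Cr + T / 4 := by linarith
  have hK1 : (0 : ℝ) < 4 * (1 + Kc) := by positivity
  rw [div_mul_eq_mul_div, div_le_iff₀ hK1]
  nlinarith [hCr_nonneg]

end Summit.QuantumAdvantage.AdviceFreeQNC0
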